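import Summits.KontsevichZagierPeriods.Zeta5Search.DenomLaw.OrbitCreditCasoratian
import Summits.KontsevichZagierPeriods.Zeta5Search.PalindromicWBound

/-!
# ζ(5) search — DENOM-LAW track D3/D2: the termwise `W` bound `WB′` and the CASORATIAN CLASS-ORBIT BOUND `COBcas` are theorems

Eighth file of the OrbitCredit lineage (statement words: denom-theory-d3 g4, `HOME/denom-law/code/d3g4/coblaw.py` items (5) and (7);
Lean: denom-engine-d2 g5, the prover seat of record of the lineage).  DENOM-LAW-PLAN LEAD UPDATE 5, Monday read (β): «COBcas ≤ v_p(Cas₇)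
as a one-file corollary of LB⁺ + WB′».  Content, for `b` in the Brown–Zudilin polytope and a window prime `5 ≤ p ≤ b₀ < p² − 2`:

* `wbPrime b p` = **`WB′(b,p)`**, verbatim item (5) of `coblaw.py`: the minimum, over the residue classes `x (mod p)` that contain a
  pole of ORDER ≥ 3 (the only classes whose piece `W_x = Σ_{q ∈ x} c_{2,q}` of the ζ(3)-coefficient `W = Σ_q c_{2,q}` can be non-zero),
  of `E_x + 3` if the class has at least two poles and of `max(E_x + 3, 0)` if it has exactly one; `0` if there is no such class.
  **`wbPrime_le_padicValRat_coeffW`**: `W(b) ≠ 0 → WB′(b,p) ≤ v_p(W(b))` (needs only `p² > b₀ + 2`) — THEOREM A (`clusterBound_holds`)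
  termwise, THEOREM A′ (`isolatedPoleIntegral_holds`, through `padicNorm_classW_le_one`) on single-pole classes, and
  `pfData_eq_zero_of_order_le` for the classes without a pole of order ≥ 3.
* `cobCas b j p v v'` = **`COBcas`** = `min(WB′(b + e_j) + VB⁺(b), WB′(b) + VB⁺(b + e_j))` for given values `v = VB⁺(b)`, `v' = VB⁺(b + e_j)`
  of `vbPlus`; **`cobCas_le_padicValRat_casoratian`**: `Cas_j(b) ≠ 0 → COBcas ≤ v_p(Cas_j(b))`, `Cas_j(b) = W(b+e_j)V(b) − W(b)V(b+e_j)`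
  — the ultrametric inequality with `WB′ ≤ v_p(W)` (this file) and the CLASS-ORBIT BOUND `VB⁺ ≤ v_p(V)` (`classOrbitBound_holds`,
  `DenomLaw/OrbitCredit.lean`, p358010).  Registered by name as `CasoratianCOBBound` / `casoratianCOBBound_holds`.
CONSEQUENCE for the track: theory-d3's sealed denominator column `E_COB(b,p;j) = −(v_p(ρ) + COBcas)` (SYMMETRY-D3 §9.5, seal P-D3-COB
e045d745…) is now a CERTIFIED bound on the Casoratian side, like `LB⁺` (`casoratianOrbitBound_holds`, p359277); the two are not
comparable in general (MODEL-side count on the 21,458 census ts6 window cells: `LB⁺` sharper on 2,524, `COBcas` sharper on 155).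
HONEST FRAMING: systematic search; p-adic valuation bounds for the rational numbers `W(b)`, `Cas_j(b)` of the cell's dual linear forms;
every exactness rate quoted is MODEL-side data; nothing about ζ(5); no γ moves; no irrationality claim; records in print UNMOVED.
-/

open Finset
open Summit.KontsevichZagierPeriods.Zeta5Search.WedgeDictionary (coeffW coeffV pfData)
open Summit.KontsevichZagierPeriods.Zeta5Search.CasoratianValuation (InPolytope shift casoratian)

namespace Summit.KontsevichZagierPeriods.Zeta5Search.ClusterValuation.Orbit

open Summit.KontsevichZagierPeriods.Zeta5Search.ClusterValuation
open Summit.KontsevichZagierPeriods.Zeta5Search.PadicSeries (one_le_p zpow_p_nonneg)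
open Summit.KontsevichZagierPeriods.Zeta5Search.BigPrime (shift_zero)
open Summit.KontsevichZagierPeriods.Zeta5Search.CellA (classW coeffW_eq_sum_classW pfData_eq_zero_of_order_le)

/-! ### `WB′`: the termwise class bound for `W` -/

/-- The `WB′`-row of the class of `x`: `E_x + 3` for a class with at least two poles, `max(E_x + 3, 0)` for a single-pole class —
defined (`some`) exactly when the class contains a pole of order ≥ 3 (`netExp ≤ −3`). -/
def wbPrimeRow (b : ℕ → ℤ) (p x : ℕ) : Option ℤ :=
  if 1 ≤ ((classSet b p x).filter fun q => netExp b q ≤ -3).card then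
    some (if 2 ≤ classPoleCount b p x then classExp b p x + 3 else max (classExp b p x + 3) 0)
  else none

/-- **`WB′(b,p)`** (`coblaw.py` item (5)): the least `WB′`-row over the classes `x < p` containing a pole of order ≥ 3; `0` if none. -/
def wbPrime (b : ℕ → ℤ) (p : ℕ) : ℤ :=
  (((List.range p).filterMap (wbPrimeRow b p)).min?).getD 0

/-- **`WB′ ≤ v_p(W)` as a registered statement** (PROVED below, `wbPrimeBound_holds`; tagged `@[conjecture]` only so that the audit
registers the proof-of-item edge, as for `ClassOrbitBound`). -/
@[conjecture] def WBPrimeBound : Prop :=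
  ∀ (b : ℕ → ℤ) (p : ℕ), InPolytope b → p.Prime → 5 ≤ p → (b 0 + 2 : ℤ) < (p : ℤ) ^ 2 → coeffW b ≠ 0 →
    wbPrime b p ≤ padicValRat p (coeffW b)

variable {p : ℕ} [hp : Fact p.Prime]

omit hp in
/-- A class with a pole of order ≥ 3 bounds `WB′` by its row. -/
theorem wbPrime_le_row (b : ℕ → ℤ) {x : ℕ} (hx : x < p) {r : ℤ} (hr : wbPrimeRow b p x = some r) : wbPrime b p ≤ r := by
  unfold wbPrime
  exact getD_min_le (List.mem_filterMap.2 ⟨x, List.mem_range.2 hx, hr⟩)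

omit hp in
/-- Without a pole of order ≥ 3 in the class, `W_x = 0` (`c_{2,q} = 0` for `−netExp q ≤ 2`). -/
theorem classW_eq_zero_of_noOrderThree (b : ℕ → ℤ) (hb : InPolytope b) {x : ℕ}
    (h0 : ((classSet b p x).filter fun q => netExp b q ≤ -3).card = 0) : classW b p x = 0 := by
  refine sum_eq_zero fun q hq => pfData_eq_zero_of_order_le b hb (le_of_mem_classSet b hq) (by norm_num) ?_
  have hnot : ¬ netExp b q ≤ -3 := fun h => by
    have : q ∈ (classSet b p x).filter fun q => netExp b q ≤ -3 := mem_filter.2 ⟨hq, h⟩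
    rw [card_eq_zero] at h0
    simp [h0] at this
  push_cast; omega

/-- THEOREM A termwise: `‖W_x‖_p ≤ p^{−(E_x + 3)}` for every class. -/
theorem padicNorm_classW_le_classExp (b : ℕ → ℤ) (hb : InPolytope b) (hp5 : 5 ≤ p) (hwin : (b 0 + 2 : ℤ) < (p : ℤ) ^ 2)
    (x : ℕ) : padicNorm p (classW b p x) ≤ (p : ℚ) ^ (-(classExp b p x + 3)) := by
  refine padicNorm.sum_le' (fun q hq => ?_) (zpow_p_nonneg _)
  by_cases hz : pfData b 2 q = 0
  · rw [hz, padicNorm.zero]; exact zpow_p_nonneg _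
  have hA := clusterBound_holds b p q 2 hb hp.out (by omega) hwin (le_of_mem_classSet b hq) (by norm_num) hz
  rw [classExp_eq_of_mem hq] at hA
  rw [padicNorm.eq_zpow_of_nonzero hz]
  exact zpow_le_zpow_right₀ one_le_p (by push_cast at hA ⊢; linarith)

/-- The row bound: `‖W_x‖_p ≤ p^{−r_x}` whenever the `WB′`-row `r_x` is defined. -/
theorem padicNorm_classW_le_row (b : ℕ → ℤ) (hb : InPolytope b) (hp5 : 5 ≤ p) (hwin : (b 0 + 2 : ℤ) < (p : ℤ) ^ 2)
    {x : ℕ} {r : ℤ} (hr : wbPrimeRow b p x = some r) : padicNorm p (classW b p x) ≤ (p : ℚ) ^ (-r) := by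
  unfold wbPrimeRow at hr
  split_ifs at hr with hord hmulti
  · cases hr
    exact padicNorm_classW_le_classExp b hb hp5 hwin x
  · cases hr
    have hpos : 1 ≤ classPoleCount b p x := by
      obtain ⟨q, hq⟩ := card_pos.1 (by omega : 0 < ((classSet b p x).filter fun q => netExp b q ≤ -3).card)
      obtain ⟨hqC, hq3⟩ := mem_filter.1 hq
      exact card_pos.2 ⟨q, mem_filter.2 ⟨hqC, by omega⟩⟩
    have hone : classPoleCount b p x = 1 := by omega
    rcases le_total (classExp b p x + 3) 0 with hle | hle
    · rw [max_eq_right hle, neg_zero, zpow_zero]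
      exact padicNorm_classW_le_one b hb hp5 hwin hone
    · rw [max_eq_left hle]
      exact padicNorm_classW_le_classExp b hb hp5 hwin x

/-- **`WB′(b,p) ≤ v_p(W(b))`** for `b` in the polytope, `p ≥ 5` prime, `p² > b₀ + 2`, `W(b) ≠ 0`. -/
theorem wbPrime_le_padicValRat_coeffW (b : ℕ → ℤ) (hb : InPolytope b) (hp5 : 5 ≤ p) (hwin : (b 0 + 2 : ℤ) < (p : ℤ) ^ 2)
    (hW : coeffW b ≠ 0) : wbPrime b p ≤ padicValRat p (coeffW b) := by
  apply val_ge_of_padicNorm_le hW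
  rw [coeffW_eq_sum_classW b hp.out.pos]
  refine padicNorm.sum_le' (fun x hx => ?_) (zpow_p_nonneg _)
  have hx' := mem_range.1 hx
  cases hr : wbPrimeRow b p x with
  | none =>
    have h0 : ((classSet b p x).filter fun q => netExp b q ≤ -3).card = 0 := by
      unfold wbPrimeRow at hr; split_ifs at hr with h; omega
    rw [classW_eq_zero_of_noOrderThree b hb h0, padicNorm.zero]; exact zpow_p_nonneg _
  | some r =>
    exact (padicNorm_classW_le_row b hb hp5 hwin hr).trans (zpow_le_zpow_right₀ one_le_p (by linarith [wbPrime_le_row b hx' hr]))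

omit hp in
/-- **`WB′ ≤ v_p(W)` is a theorem.** -/
theorem wbPrimeBound_holds : WBPrimeBound := fun b p hb hprime hp5 hwin hW => by
  haveI : Fact p.Prime := ⟨hprime⟩
  exact wbPrime_le_padicValRat_coeffW b hb hp5 hwin hW

/-! ### `COBcas`: the Casoratian class-orbit bound -/

/-- **`COBcas(b,p;j)`** for given values `v = VB⁺(b,p)`, `v' = VB⁺(b+e_j,p)`: `min(WB′(b+e_j) + v, WB′(b) + v')` (`coblaw.py` item (7),
the Casoratian part of `E_COB = −(v_p(ρ) + COBcas)`). -/
def cobCas (b : ℕ → ℤ) (j p : ℕ) (v v' : ℤ) : ℤ := min (wbPrime (shift b j) p + v) (wbPrime b p + v')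

/-- **THE CASORATIAN CLASS-ORBIT BOUND as a registered statement** (PROVED below, `casoratianCOBBound_holds`): for `b` and `b + e_j`
in the polytope (`1 ≤ j`), `5 ≤ p ≤ b₀ < p² − 2` prime, `VB⁺(b) = v`, `VB⁺(b+e_j) = v'` and `Cas_j(b) ≠ 0`: `COBcas ≤ v_p(Cas_j(b))`. -/
@[conjecture] def CasoratianCOBBound : Prop :=
  ∀ (b : ℕ → ℤ) (j p : ℕ) (v v' : ℤ), InPolytope b → 1 ≤ j → InPolytope (shift b j) →
    p.Prime → 5 ≤ p → (p : ℤ) ≤ b 0 → (b 0 + 2 : ℤ) < (p : ℤ) ^ 2 →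
      vbPlus b p = some v → vbPlus (shift b j) p = some v' → casoratian b j ≠ 0 →
        cobCas b j p v v' ≤ padicValRat p (casoratian b j)

/-- **`COBcas ≤ v_p(Cas_j(b))`**: the ultrametric inequality on `W(b+e_j)V(b) − W(b)V(b+e_j)` with `WB′ ≤ v_p(W)` and `VB⁺ ≤ v_p(V)`. -/
theorem cobCas_le_padicValRat_casoratian (b : ℕ → ℤ) {j : ℕ} (hb : InPolytope b) (hj1 : 1 ≤ j) (hb' : InPolytope (shift b j))
    (hp5 : 5 ≤ p) (hpb : (p : ℤ) ≤ b 0) (hwin : (b 0 + 2 : ℤ) < (p : ℤ) ^ 2) {v v' : ℤ} (hv : vbPlus b p = some v)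
    (hv' : vbPlus (shift b j) p = some v') (hcas : casoratian b j ≠ 0) :
    cobCas b j p v v' ≤ padicValRat p (casoratian b j) := by
  have hp1 : (1 : ℚ) ≤ p := one_le_p
  have h0' : shift b j 0 = b 0 := shift_zero b hj1
  have hwin' : (shift b j 0 + 2 : ℤ) < (p : ℤ) ^ 2 := by rw [h0']; exact hwin
  have hpb' : (p : ℤ) ≤ shift b j 0 := by rw [h0']; exact hpb
  -- the four factor bounds
  have hW : padicNorm p (coeffW b) ≤ (p : ℚ) ^ (-wbPrime b p) :=
    padicNorm_le_of_val fun h => wbPrime_le_padicValRat_coeffW b hb hp5 hwin h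
  have hW' : padicNorm p (coeffW (shift b j)) ≤ (p : ℚ) ^ (-wbPrime (shift b j) p) :=
    padicNorm_le_of_val fun h => wbPrime_le_padicValRat_coeffW (shift b j) hb' hp5 hwin' h
  have hV : padicNorm p (coeffV b) ≤ (p : ℚ) ^ (-v) :=
    padicNorm_le_of_val fun h => classOrbitBound_holds b p v hb hp.out hp5 hpb hwin hv h
  have hV' : padicNorm p (coeffV (shift b j)) ≤ (p : ℚ) ^ (-v') :=
    padicNorm_le_of_val fun h => classOrbitBound_holds (shift b j) p v' hb' hp.out hp5 hpb' hwin' hv' h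
  -- the two products and their difference
  apply val_ge_of_padicNorm_le hcas
  unfold casoratian
  refine (padicNorm.sub (p := p)).trans (max_le ?_ ?_)
  · exact (padicNorm_mul_le hW' hV).trans (zpow_le_zpow_right₀ hp1 (by unfold cobCas; omega))
  · exact (padicNorm_mul_le hW hV').trans (zpow_le_zpow_right₀ hp1 (by unfold cobCas; omega))

omit hp in
/-- **The Casoratian class-orbit bound is a theorem.** -/
theorem casoratianCOBBound_holds : CasoratianCOBBound := fun b j p v v' hb hj1 hb' hprime hp5 hpb hwin hv hv' hcas => by
  haveI : Fact p.Prime := ⟨hprime⟩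
  exact cobCas_le_padicValRat_casoratian b hb hj1 hb' hp5 hpb hwin hv hv' hcas

end Summit.KontsevichZagierPeriods.Zeta5Search.ClusterValuation.Orbit
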